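import Summits.ABC.IUTFork.Repair.ScalarShellsThm311
import Summits.ABC.IUTFork.Cor312PinnedRegionsThreePins
import HarnessLib

/-!
# IUT REPAIR branch, sub-cell B5 — SAFETY RAIL: over the balls-only scaling-shells data `sFull` NO pin-respecting setting exists

Record file (D-0012) of the abc-iut cell, IUT REPAIR branch; seat abc-iut-rp-s3 (prover). PROOF-ONLY; a MODEL-DESIGN fact about the branch's
model beds (the kernel form of the «design blocker» of abc-iut-rp-j1 07:28Z / rp-j2 07:34Z / rp-s3 07:49Z, accepted in abc-iut-rp-plan RULINGS #22
and answered by abc-iut-w4-d098's bed `sFull₀` and abc-iut-rp-j2's / abc-iut-rp-s2's beds); TAKES NO SIDE on [IUTchIII] Cor. 3.12 — nothing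
here bears on print.

WHAT. Over abc-iut-w4-d098's layer-2 data `ScalarShellsThm311.sFull p` (scaling shells, admissible regions = the `p`-adic BALLS at EVERY label,
including the junk label `0`): for EVERY Cor.-3.12 setting `P`, EVERY region operator `ρ` and EVERY q-datum `qK`, the equivariance clause (hρ) and
the q-pin (pq′) CANNOT both hold (`no_equivariant_qPin_over_sFull`); hence `¬ PinnedRegions`, `¬ PinnedRegions3` there. Mechanism: the group
`⟨(Ind1) ∪ (Ind2)⟩` of the scaling shells contains the family `Φ₀` rescaling the label-`0` packet by `p` and acting as the identity on every star
packet (labels of `𝔽_l^⋇` only), so (hρ) at `(Φ₀, qK, 0)` says `ρ qK 0 = p · ρ qK 0`, while (pq′) + `Setting.qRegion_mem` + `hul_adm` make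
`ρ qK 0` an admissible region, i.e. a ball — and no ball is fixed by `p`. CONSEQUENCE for the census: any evaluation cell that ASSUMES the pins over
`sFull` has a vacuous antecedent; pinned cells live on `sFull₀` (w4-d098), `CandJoshi22.scaleFull` (rp-j2) or `ObstructionSS10.sLattice` (rp-s2),
whose data admit a scale-invariant region at the junk label. [claim: Mochizuki2012, status: disputed]
-/

noncomputable section

open Set

namespace Summit.ABC.IUTFork.Repair.ObstructionSS33

open Thm311 Cor312 Cor312.Checks Cor312.IdentifiedNonVacuity Cor312Vol Cor312Vol.NaiveWitness Cor312Vol.UnitWitness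
  Cor312Vol.PinnedWitness Literature.IUT.LogThetaLattice Summit.ABC.IUTFork.Repair.ScalarShells
  Summit.ABC.IUTFork.Repair.ScalarShellsThm311

variable (p : ℕ) [hp : Fact p.Prime]

/-- The label-`0`-only rescaling `Φ₀ := sFamDep (j ↦ if j = 0 then p else 1)` (scalar `p` at the junk label, `1` on `𝔽_l^⋇`; an
(Ind2)-family of the scaling shells, abc-iut-w4-d098's `sFamDep`) lies in `⟨(Ind1) ∪ (Ind2)⟩`. [folklore] -/
theorem zeroFam_mem_closure :
    sFamDep p (fun j : toyIndex.Label => if j = 0 then pUnit p else 1) ∈ Subgroup.closure ((scalingShells p).Ind1Family ∪ (scalingShells p).Ind2Family) :=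
  sFamDep_mem_closure p _

/-- `Φ₀` is the identity on every packet of a NONZERO label. [folklore] -/
theorem zeroFam_apply_of_ne_zero {j : toyIndex.Label} (hj : j ≠ 0) (vQ : toyIndex.VQ) (x : (scalingShells p).Packet j vQ) :
    sFamDep p (fun j : toyIndex.Label => if j = 0 then pUnit p else 1) j vQ x = x := by
  apply (line j vQ).injective
  rw [line_sFamDep]
  simp only [if_neg hj, Units.val_one, one_pow, one_mul]

/-- Hence `Φ₀` fixes every bad-place datum: `Φ₀ · X = X` (the star packets see only the labels of `𝔽_l^⋇`). [folklore] -/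
theorem starAut_zeroFam_image (X : ∀ v : toyIndex.V, v ∈ toyIndex.Vbad → Set ((scalingShells p).StarPacket v)) :
    (fun v hv => (scalingShells p).starAut (sFamDep p (fun j : toyIndex.Label => if j = 0 then pUnit p else 1)) v '' X v hv) = X := by
  funext v hv
  have hid : ∀ ψ : (scalingShells p).StarPacket v, (scalingShells p).starAut (sFamDep p (fun j : toyIndex.Label => if j = 0 then pUnit p else 1)) v ψ = ψ := fun ψ =>
    funext fun j => zeroFam_apply_of_ne_zero p j.2 _ _
  ext ψ
  constructor
  · rintro ⟨φ, hφ, rfl⟩; rw [hid]; exact hφ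
  · intro hψ; exact ⟨ψ, hψ, hid ψ⟩

/-- At the junk label `Φ₀` sends `B_k` onto `B_{k+1}`. [folklore] -/
theorem zeroFam_image_sBall_zero (vQ : toyIndex.VQ) (k : ℤ) :
    sFamDep p (fun j : toyIndex.Label => if j = 0 then pUnit p else 1) 0 vQ '' sBall p ⊤ 0 vQ k = sBall p ⊤ 0 vQ (k + 1) := by
  rw [image_sBall_sFamDep]
  simp only [padicValRat_pUnit, ite_true]
  norm_num

/-- **NO EQUIVARIANT q-PIN OVER `sFull`.** For every setting over the balls-only scaling data, every operator `ρ` satisfying the equivariance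
clause (hρ) for the whole group, and every q-datum: the q-pin (pq′) fails. (The q-pilot image at the junk label is an admissible region — a ball
— by `Setting.qRegion_mem` + `hul_adm`; (hρ) at the label-`0`-only rescaling `Φ₀`, which fixes the datum, would make that ball `p`-invariant.)
[folklore] -/
theorem no_equivariant_qPin_over_sFull (P : Setting (sFull p).toLatticeSituation.toSituation)
    (ρ : (∀ v : toyIndex.V, v ∈ toyIndex.Vbad → Set ((scalingShells p).StarPacket v)) →
      ∀ (j : toyIndex.Label) (vQ : toyIndex.VQ), Set ((scalingShells p).Packet j vQ))
    (qK : ∀ v : toyIndex.V, v ∈ toyIndex.Vbad → Set ((scalingShells p).StarPacket v))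
    (hρ : ∀ Φ ∈ Subgroup.closure ((scalingShells p).Ind1Family ∪ (scalingShells p).Ind2Family),
      ∀ (X : ∀ v : toyIndex.V, v ∈ toyIndex.Vbad → Set ((scalingShells p).StarPacket v)) (j : toyIndex.Label) (vQ : toyIndex.VQ),
        ρ (fun v hv => (scalingShells p).starAut Φ v '' X v hv) j vQ = Φ j vQ '' ρ X j vQ)
    (hq : QPinned (sFull p).toLatticeSituation P ρ qK) : False := by
  obtain ⟨k, hk⟩ : ∃ k, P.qRegion 0 () = sBall p ⊤ 0 () k := P.hul_adm 0 () _ (P.qRegion_mem 0 ())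
  have h := hρ _ (zeroFam_mem_closure p) qK 0 ()
  rw [starAut_zeroFam_image, ← hq 0 (), hk, zeroFam_image_sBall_zero] at h
  have := sBall_injective p ⊤ 0 () h
  omega

/-- **Hence NO setting over `sFull` carries the two region pins.** [folklore] -/
theorem not_pinnedRegions_over_sFull (P : Setting (sFull p).toLatticeSituation.toSituation)
    (ρ : (∀ v : toyIndex.V, v ∈ toyIndex.Vbad → Set ((scalingShells p).StarPacket v)) →
      ∀ (j : toyIndex.Label) (vQ : toyIndex.VQ), Set ((scalingShells p).Packet j vQ))
    (qK : ∀ v : toyIndex.V, v ∈ toyIndex.Vbad → Set ((scalingShells p).StarPacket v)) :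
    ¬ PinnedRegions (sFull p).toLatticeSituation P ρ qK :=
  fun h => no_equivariant_qPin_over_sFull p P ρ qK h.1.1 h.2

/-- … nor the three pins. So every candidate-evaluation cell that assumes `PinnedRegions(3)` over `sFull` is VACUOUS; pinned cells belong on the
beds with a scale-invariant admissible junk-label region (`sFull₀`, `CandJoshi22.scaleFull`, `ObstructionSS10.sLattice`). [folklore] -/
theorem not_pinnedRegions3_over_sFull (P : Setting (sFull p).toLatticeSituation.toSituation)
    (ρ : (∀ v : toyIndex.V, v ∈ toyIndex.Vbad → Set ((scalingShells p).StarPacket v)) →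
      ∀ (j : toyIndex.Label) (vQ : toyIndex.VQ), Set ((scalingShells p).Packet j vQ))
    (qK : ∀ v : toyIndex.V, v ∈ toyIndex.Vbad → Set ((scalingShells p).StarPacket v)) :
    ¬ PinnedRegions3 (sFull p).toLatticeSituation P ρ qK :=
  fun h => not_pinnedRegions_over_sFull p P ρ qK h.1

end Summit.ABC.IUTFork.Repair.ObstructionSS33

end
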